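import Summits.AtomisticToContinuum.HydrodynamicLimit.Theorems.AntiMazurCoboundariesCorrectorPressureDecayKiferFreeBoxExactCount
import Summits.AtomisticToContinuum.HydrodynamicLimit.Theorems.AntiMazurCoboundariesCorrectorPressureDecayKiferFreeBoxCountVariance

/-!
# The exact-count lower bound for free boxes, unconditional form (line `FirstLemma`, crux stmt-AtomisticToContinuum-14135)

Helper file of the registered stub `stub_tangentEntropyBoundUniformGibbs` (Gibbs route, thermodynamic step (B)), namespace
`Summit.AtomisticToContinuum.HydrodynamicLimit.Theorems.KiferCompactification`; lead seat c9. The registered sub-goal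
`c9_free_box_count_ge_exp_neg` (B4') is the conditional form `c9_free_box_count_ge_exp_neg_of_var` (…KiferFreeBoxExactCount) fed with the
general-box variance bound `c9_free_box_count_variance_le` (B2', …KiferFreeBoxCountVariance).
-/

noncomputable section

open MeasureTheory ProbabilityTheory Set Filter Topology InformationTheory
open scoped ENNReal NNReal

namespace Summit.AtomisticToContinuum.HydrodynamicLimit.Theorems.KiferCompactification

open Literature.MathematicalPhysics.KineticTheory (T3 V3)
open Literature.MathematicalPhysics.KineticTheory.HardSphereDLR (gibbsSpecMeasure)
open Literature.MathematicalPhysics.KineticTheory.PointProcess (density)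
open Literature.Analysis.FluidPDE (IsHardSphereGibbs IsTranslationInvariant)
open Literature.Analysis.FunctionSpaces (PointConfig)

/-- **(B4') THE EXACT-COUNT LOWER BOUND FOR FREE BOXES** (registered sub-goal `c9_free_box_count_ge_exp_neg`): a free low-activity
hard-sphere box of large side `ℓ` gives every particle number within `2ℓ² + 10` of `density(G)·ℓ³` probability at least `exp(-η ℓ³)`,
`G` being a translation-invariant Gibbs state at the same activity. -/
theorem c9_free_box_count_ge_exp_neg {z β : ℝ} {u : V3} (hz : 0 < z) (hz1 : z ≤ 1 / 64) (hβ : 0 < β)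
    {G : Measure (PointConfig (V3 × V3))} (hG : IsHardSphereGibbs 1 z β u G) (hGT : IsTranslationInvariant G)
    {η : ℝ} (hη : 0 < η) :
    ∃ ℓ₀ : ℝ, 0 < ℓ₀ ∧ ∀ (a : V3) (ℓ : ℝ), ℓ₀ ≤ ℓ → ∀ k : ℕ, |(k : ℝ) - (density G).toReal * ℓ ^ 3| ≤ 2 * ℓ ^ 2 + 10 →
      ENNReal.ofReal (Real.exp (-(η * ℓ ^ 3))) ≤ gibbsSpecMeasure 1 z β u (c9Box a ℓ) ∅ {ω | ω.count univ = k} := by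
  exact c9_free_box_count_ge_exp_neg_of_var hz hz1 hβ hG hGT (c9_free_box_count_variance_le hz hz1 hβ) hη

end Summit.AtomisticToContinuum.HydrodynamicLimit.Theorems.KiferCompactification

end
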